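import Summits.Ventures.HodgeRepro2.T5SU11PhaseTail

/-!
# The law of the orbit radius: `P_k(|g·0|² > y) = (1 − y)^{(k−2)/2}` — a Beta law

The phase and the orbit radius are tied by `1 − |g·0|² = |a(g)|^{−2}` (`T5BergmanCoefficient.one_sub_norm_orbit_sq`),
so `{|g·0|² > y} = {log|a(g)| > −½ log(1 − y)}` and the exponential tail of `T5SU11PhaseTail` becomes

  **`∫⁻_{|g·0|² > y} (1 − |g·0|²)^{k/2} dν = 2π (1 − y)^{(k−2)/2}/(k − 2)`,   `P_k(|g·0|² > y) = (1 − y)^{(k−2)/2}`**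

for `k > 2`, `0 ≤ y < 1` (`lintegral_orbit_sq_tail`, `orbit_sq_tail_prob`): under `(1 − |g·0|²)^{k/2} dν` the
squared orbit radius is `Beta(1, (k − 2)/2)`-distributed (density `((k−2)/2)(1 − y)^{(k−2)/2 − 1}` on `(0, 1)`);
for the weight `3`, `P_3(|g·0|² > y) = √(1 − y)`. Nothing is claimed about (N).

Blind lane: Mathlib + the HodgeRepro2 prefix only; no sorry; axioms ⊆ {propext, Classical.choice,
Quot.sound}.
-/

namespace Summit.Ventures.HodgeRepro2.T5SU11OrbitRadiusLaw

open MeasureTheory MeasureTheory.Measure Metric Set Filter Topology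
open T5SU11Unimodular T5SU11Fibration T5SU11Cartan T5SU11CartanProjection T5HaarCircle
  T5BergmanCoefficient T5SU11FibrationHaar T5SU11JacobiWeight T5SU11PhaseLaw T5SU11PhaseLawLintegral
  T5SU11PhaseTail
open scoped Real ENNReal

/-- `|g·0|² = 1 − e^{−2 log|a(g)|}`. -/
lemma norm_orbit_sq_eq (g : SU11) :
    ‖orbit g‖ ^ 2 = 1 - Real.exp (-(2 * Real.log ‖mat g 0 0‖)) := by
  have h := one_sub_norm_orbit_sq g
  have ha : 0 < ‖mat g 0 0‖ := norm_mat_pos g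
  have e : Real.exp (-(2 * Real.log ‖mat g 0 0‖)) = ‖mat g 0 0‖⁻¹ ^ 2 := by
    rw [show -(2 * Real.log ‖mat g 0 0‖) = Real.log ‖mat g 0 0‖⁻¹ * 2 by
      rw [Real.log_inv]; ring, Real.exp_mul, Real.exp_log (inv_pos.mpr ha), Real.rpow_two]
  rw [e]
  linarith

/-- `{|g·0|² > y} = {log|a(g)| > −½ log(1 − y)}` for `y < 1`. -/
lemma setOf_norm_orbit_sq_gt_eq {y : ℝ} (hy : y < 1) :
    {g : SU11 | y < ‖orbit g‖ ^ 2} = {g : SU11 | -(1 / 2) * Real.log (1 - y) < Real.log ‖mat g 0 0‖} := by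
  ext g
  simp only [mem_setOf_eq]
  rw [norm_orbit_sq_eq]
  have h1 : 0 < 1 - y := by linarith
  constructor
  · intro h
    -- `e^{−2s} < 1 − y`, hence `−2s < log(1 − y)`
    have h2 : Real.exp (-(2 * Real.log ‖mat g 0 0‖)) < 1 - y := by linarith
    have h3 := Real.log_lt_log (Real.exp_pos _) h2
    rw [Real.log_exp] at h3
    linarith
  · intro h
    have h2 : -(2 * Real.log ‖mat g 0 0‖) < Real.log (1 - y) := by linarith
    have h3 := Real.exp_lt_exp.mpr h2
    rw [Real.exp_log h1] at h3
    linarith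

section measure

variable [MeasurableSpace Circle] [BorelSpace Circle]

/-- **The tail of the orbit radius**: for `k > 2`, `0 ≤ y < 1`,
`∫⁻_{|g·0|² > y} (1 − |g·0|²)^{k/2} dν = 2π (1 − y)^{(k−2)/2}/(k − 2)`. -/
theorem lintegral_orbit_sq_tail {k y : ℝ} (hk : 2 < k) (hy0 : 0 ≤ y) (hy1 : y < 1) :
    ∫⁻ g, {g : SU11 | y < ‖orbit g‖ ^ 2}.indicator
        (fun g => ENNReal.ofReal ((1 - ‖orbit g‖ ^ 2) ^ (k / 2))) g ∂(nu haarCircle)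
      = ENNReal.ofReal (2 * π * (1 - y) ^ ((k - 2) / 2) / (k - 2)) := by
  have h1 : 0 < 1 - y := by linarith
  have hx : 0 ≤ -(1 / 2) * Real.log (1 - y) := by
    have := Real.log_nonpos h1.le (by linarith)
    linarith
  rw [setOf_norm_orbit_sq_gt_eq hy1, lintegral_phase_tail hk hx]
  congr 2
  rw [Real.rpow_def_of_pos h1]
  ring_nf

/-- **`P_k(|g·0|² > y) = (1 − y)^{(k−2)/2}`** — the `Beta(1, (k−2)/2)` law of the squared orbit radius. -/
theorem orbit_sq_tail_prob {k y : ℝ} (hk : 2 < k) (hy0 : 0 ≤ y) (hy1 : y < 1) :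
    (∫⁻ g, {g : SU11 | y < ‖orbit g‖ ^ 2}.indicator
        (fun g => ENNReal.ofReal ((1 - ‖orbit g‖ ^ 2) ^ (k / 2))) g ∂(nu haarCircle))
      / ENNReal.ofReal (2 * π / (k - 2)) = ENNReal.ofReal ((1 - y) ^ ((k - 2) / 2)) := by
  have h1 : 0 < 1 - y := by linarith
  have hx : 0 ≤ -(1 / 2) * Real.log (1 - y) := by
    have := Real.log_nonpos h1.le (by linarith)
    linarith
  rw [setOf_norm_orbit_sq_gt_eq hy1, phase_tail_prob hk hx]
  congr 1
  rw [Real.rpow_def_of_pos h1]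
  ring_nf

/-- **Weight `3`**: `P_3(|g·0|² > y) = √(1 − y)`. -/
theorem orbit_sq_tail_prob_three {y : ℝ} (hy0 : 0 ≤ y) (hy1 : y < 1) :
    (∫⁻ g, {g : SU11 | y < ‖orbit g‖ ^ 2}.indicator
        (fun g => ENNReal.ofReal ((1 - ‖orbit g‖ ^ 2) ^ ((3 : ℝ) / 2))) g ∂(nu haarCircle))
      / ENNReal.ofReal (2 * π / (3 - 2)) = ENNReal.ofReal (Real.sqrt (1 - y)) := by
  rw [orbit_sq_tail_prob (by norm_num) hy0 hy1, show ((3 : ℝ) - 2) / 2 = 1 / 2 by norm_num,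
    Real.sqrt_eq_rpow]

end measure

end Summit.Ventures.HodgeRepro2.T5SU11OrbitRadiusLaw
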